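import Literature.AlgebraicGeometry.Resolution.OrderSemicontinuity
import Literature.AlgebraicGeometry.Resolution.ExcellentRingsFieldProofs
import Literature.AlgebraicGeometry.Resolution.MaximalContact
import HarnessLib

/-!
# Upper semicontinuity of the order of a section on a smooth scheme over a field (door H2a‴, clause (c8) at ι = ord)

Topic: `Summits/ResolutionOfSingularities/ResolutionOfSingularities/Theorems`. Helper for the door item
`HypersurfaceCentreConstruction` (statement `stmt-ResolutionOfSingularities-19897`, route `WeightedInvariant`),
design clause (c8) `IotaUpperSemicontinuous` of `res-L1-w43-plan-1`'s H2a‴ sketch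
(`L/res-L1-w43-plan-1/eft_sketch_v6.lean`, sha16 `466626a584f3567b`: «every super-level set of
`y ↦ ι 𝒪_{Y,y} f_y` is closed, for `Y` SMOOTH quasi-compact over a field») AT THE FIRST ι-INSTANCE
ι = the 𝔪-adic order (ORDER (o11)).  This file is the Diff-free, field-agnostic half (object (A) of
res-type-039, STATUS 2026-08-27T05:19:51Z); the differential description over a perfect field is ORDER (o15).

[OURS · L1 W4.3] Replaces the role of NO printed item; NOT a statement of the manuscript
[claim: Hironaka2017, status: under-review]. AI work, weaker than expert review.

## What is proved

* `OrderSemicontinuity.isClosed_setOf_le_idealOrder_of_isJ2_general` — on a Noetherian REGULAR scheme whose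
  affine coordinate rings are J-2, for an ARBITRARY ideal sheaf `J` and every `n : ℕ∞`, the super-level set
  `{x | n ≤ ord_x(J)}` is closed.  This is the tree's `Resolution.isClosed_setOf_le_idealOrder_of_isJ2`
  (Cossart–Piltant 2008, proof of Prop. 4.2) with its binders `[IsIntegral X]` and `J ≠ ⊥` REMOVED: the
  points of infinite order lie in every super-level set, and the generic-bound argument
  (`Resolution.exists_opens_forall_idealOrder_le_of_isJ2`) never used integrality — its one domain-dependent
  step is replaced by `IsLocalization.algebraMap_mem_map_algebraMap_iff`
  (`exists_mul_mem_pow_of_algebraMap_mem_maximalIdeal_pow_general`).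
* `OrderSemicontinuity.isClosed_setOf_le_idealOrder_general` — the same with «excellent» for «J-2».
* `OrderSemicontinuity.le_idealOrder_span_singleton_iff` — `n ≤ ord_x(f) ↔ germ_x f ∈ 𝔪_xⁿ` for a global
  section `f` (bridge lemmas drafted by res-type-071, `plan/tools/res-type-071/GermOrderBridge.lean`
  sha16 `6185c6c3c1130b37`, reproduced here with credit).
* `isClosed_setOf_germ_mem_maximalIdeal_pow` — **for `Y` smooth and quasi-compact over ANY field `k₀` and
  `f ∈ Γ(Y, 𝒪_Y)`, every set `{y | germ_y f ∈ 𝔪_yⁿ}` is closed** (smooth ⇒ regular,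
  `Scheme.isRegular_of_smooth_over_field`; l.f.t. over a field ⇒ excellent,
  `Scheme.isExcellent_of_locallyOfFiniteType Stacks07QW_field_holds`; quasi-compact ⇒ Noetherian); and
  `isOpen_setOf_germ_eq_zero` — the zero-germ locus is open (the junk branch of any `Nat.sSup`-valued order
  function).  The adapter `IotaUpperSemicontinuous iotaOrd` is a rewriting of these two sets once (o11)'s
  `iotaOrd` is in the tree.

No perfectness of `k₀` is needed for closedness (contrast (o15): the k₀-linear Hasse–Schmidt derivatives
detect the order at inseparable points only over a perfect base).

## References

* V. Cossart, O. Piltant, J. Algebra 320 (2008), proof of Prop. 4.2 («Σ … is a closed subset of X»).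
  [cite: CossartPiltant2008, Prop. 4.2 (proof)]
* The Stacks Project, Tag 07QW (schemes l.f.t. over a field are excellent). [cite: StacksProject, Tag 07QW]
* U. Görtz, T. Wedhorn, *Algebraic Geometry I*, Lemma 6.26 (smooth over a field ⇒ regular). [GortzWedhorn2020]
-/

noncomputable section

open CategoryTheory AlgebraicGeometry TopologicalSpace Topology IsLocalRing Opposite
open Literature.AlgebraicGeometry.Resolution

set_option linter.dupNamespace false -- mandated namespace of this single-conjunct summit

namespace Summit.ResolutionOfSingularities.ResolutionOfSingularities.Theorems

namespace OrderSemicontinuity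

universe u

/-! ## Ring level: the domain-free converse of `algebraMap_mem_maximalIdeal_pow_of_mul_mem_pow` -/

/-- In a localization `S = A_P` at a prime, `x/1 ∈ (P S)ⁿ` gives `s x ∈ Pⁿ` for some `s ∉ P` — no
domain hypothesis (the tree's `Resolution.exists_mul_mem_pow_of_algebraMap_mem_maximalIdeal_pow` assumes
`IsDomain A`). [folklore] -/
theorem exists_mul_mem_pow_of_algebraMap_mem_maximalIdeal_pow_general {A : Type*} [CommRing A]
    (P : Ideal A) [P.IsPrime] (S : Type*) [CommRing S] [Algebra A S] [IsLocalization.AtPrime S P]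
    [IsLocalRing S] {n : ℕ} {x : A} (hx : algebraMap A S x ∈ maximalIdeal S ^ n) :
    ∃ s ∉ P, s * x ∈ P ^ n := by
  rw [← IsLocalization.AtPrime.map_eq_maximalIdeal P S, ← Ideal.map_pow,
    IsLocalization.algebraMap_mem_map_algebraMap_iff P.primeCompl S] at hx
  obtain ⟨s, hs, hsx⟩ := hx
  exact ⟨s, hs, hsx⟩

/-! ## The generic bound and upper semicontinuity, without integrality -/

/-- **The order of an ideal sheaf is generically `≤ ord_η` along the closure of `η`** on a locally
Noetherian regular scheme with J-2 affine coordinate rings, for ANY ideal sheaf `J` with `ord_η(J) = m`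
finite: there is an open `U ∋ η` with `ord_x(J) ≤ m` for all `x ∈ U` with `η ⤳ x`.  Proof = the tree's
`Resolution.exists_opens_forall_idealOrder_le_of_isJ2` verbatim, minus the binder `[IsIntegral X]`
(which that proof never used except through the domain form of the localization lemma).
[cite: CossartPiltant2008, Prop. 4.2 (proof)] -/
theorem exists_opens_forall_idealOrder_le_of_isJ2_general {X : Scheme.{u}}
    [IsLocallyNoetherian X] (hX : Scheme.IsRegular X)
    (hJ2 : ∀ U : X.affineOpens, IsJ2Ring Γ(X, U)) (J : X.IdealSheafData) (η : X) {m : ℕ}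
    (hm : idealOrder J η = m) :
    ∃ U : X.Opens, η ∈ U ∧ ∀ x ∈ U, η ⤳ x → idealOrder J x ≤ m := by
  -- an affine open neighbourhood `U = Spec A` of `η`
  obtain ⟨U, hU, hηU, -⟩ :=
    exists_isAffineOpen_mem_and_subset (X := X) (x := η) (U := ⊤) (Opens.mem_top η)
  haveI : Nonempty U := ⟨⟨η, hηU⟩⟩
  let A := Γ(X, U)
  haveI : IsNoetherianRing A := IsLocallyNoetherian.component_noetherian ⟨U, hU⟩
  haveI : IsRegularRing A := hX.isRegularRing_of_isAffineOpen hU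
  replace hJ2 : IsJ2Ring A := hJ2 ⟨U, hU⟩
  -- primes and stalks of points of `U`
  let 𝔓 : ∀ x : X, x ∈ U → Ideal A := fun x hx => (hU.primeIdealOf ⟨x, hx⟩).asIdeal
  have h𝔓p : ∀ x (hx : x ∈ U), (𝔓 x hx).IsPrime := fun x hx => (hU.primeIdealOf ⟨x, hx⟩).2
  set 𝔭 := 𝔓 η hηU with h𝔭
  haveI : 𝔭.IsPrime := h𝔓p η hηU
  set 𝔍 : Ideal A := J.ideal ⟨U, hU⟩ with h𝔍
  -- the order at a point of `U` read in `A`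
  have hord : ∀ (x : X) (hx : x ∈ U) (n : ℕ),
      (n : ℕ∞) ≤ idealOrder J x ↔ ∀ f ∈ 𝔍, ∃ s ∉ 𝔓 x hx, s * f ∈ 𝔓 x hx ^ n := by
    intro x hx n
    letI algx : Algebra A (X.presheaf.stalk x) := TopCat.Presheaf.algebra_section_stalk X.presheaf ⟨x, hx⟩
    haveI := h𝔓p x hx
    haveI : IsLocalization.AtPrime (X.presheaf.stalk x) (𝔓 x hx) := hU.isLocalization_stalk ⟨x, hx⟩
    have hst : stalkIdeal J x = 𝔍.map (algebraMap A (X.presheaf.stalk x)) :=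
      stalkIdeal_eq_map_germ J ⟨U, hU⟩ hx
    rw [le_idealOrder_iff, hst, Ideal.map_le_iff_le_comap]
    constructor
    · intro h f hf
      exact exists_mul_mem_pow_of_algebraMap_mem_maximalIdeal_pow_general (𝔓 x hx)
        (X.presheaf.stalk x) (h hf)
    · intro h f hf
      obtain ⟨s, hs, hsf⟩ := h f hf
      exact algebraMap_mem_maximalIdeal_pow_of_mul_mem_pow (𝔓 x hx) (X.presheaf.stalk x) hs hsf
  -- an element `f ∈ J(U)` of order exactly `m` along `𝔭`
  have hm1 : ((m : ℕ) : ℕ∞) ≤ idealOrder J η := hm.ge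
  have hm2 : ¬ ((m + 1 : ℕ) : ℕ∞) ≤ idealOrder J η := by
    rw [hm]
    exact_mod_cast Nat.not_succ_le_self m
  rw [hord η hηU] at hm1 hm2
  push Not at hm2
  obtain ⟨f, hf𝔍, hfm1⟩ := hm2
  have hfm : ∃ s ∉ 𝔭, s * f ∈ 𝔭 ^ m := hm1 f hf𝔍
  -- J-2 and the ring-level generic bound
  obtain ⟨g, hg𝔭, hg⟩ := exists_not_mem_forall_mul_not_mem_pow 𝔭 hfm hfm1
    (exists_not_mem_forall_isRegularLocalRing_quotient hJ2 𝔭)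
  -- the open set `D(g) ⊆ U`
  refine ⟨X.basicOpen g, ?_, fun x hx hηx => ?_⟩
  · rw [Scheme.mem_basicOpen (hx := hηU)]
    letI algη : Algebra A (X.presheaf.stalk η) := TopCat.Presheaf.algebra_section_stalk X.presheaf ⟨η, hηU⟩
    haveI : IsLocalization.AtPrime (X.presheaf.stalk η) 𝔭 := hU.isLocalization_stalk ⟨η, hηU⟩
    exact (IsLocalization.AtPrime.isUnit_to_map_iff (X.presheaf.stalk η) 𝔭 g).mpr hg𝔭
  · have hxU : x ∈ U := X.basicOpen_le g hx
    -- `g ∉ 𝔮 := 𝔓 x`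
    letI algx : Algebra A (X.presheaf.stalk x) := TopCat.Presheaf.algebra_section_stalk X.presheaf ⟨x, hxU⟩
    haveI := h𝔓p x hxU
    haveI : IsLocalization.AtPrime (X.presheaf.stalk x) (𝔓 x hxU) := hU.isLocalization_stalk ⟨x, hxU⟩
    have hgx : g ∉ 𝔓 x hxU := by
      rw [Scheme.mem_basicOpen (hx := hxU)] at hx
      exact (IsLocalization.AtPrime.isUnit_to_map_iff (X.presheaf.stalk x) (𝔓 x hxU) g).mp hx
    -- `𝔭 ≤ 𝔮` from `η ⤳ x` (specialisation inside the affine open)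
    have h𝔭𝔮 : 𝔭 ≤ 𝔓 x hxU := by
      change hU.primeIdealOf ⟨η, hηU⟩ ≤ hU.primeIdealOf ⟨x, hxU⟩
      have h1 : hU.fromSpec.base (hU.primeIdealOf ⟨η, hηU⟩) ⤳
          hU.fromSpec.base (hU.primeIdealOf ⟨x, hxU⟩) := by
        rw [IsAffineOpen.fromSpec_primeIdealOf, IsAffineOpen.fromSpec_primeIdealOf]
        exact hηx
      have h2 := (hU.fromSpec.isOpenEmbedding.isInducing.specializes_iff).mp h1
      exact (PrimeSpectrum.le_iff_specializes _ _).mpr h2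
    -- if `ord_x J ≥ m + 1` then `t f ∈ 𝔮^{m+1}` for some `t ∉ 𝔮`: excluded by `hg`
    by_contra hlt
    have hle : ((m + 1 : ℕ) : ℕ∞) ≤ idealOrder J x := by
      rw [not_le] at hlt
      exact Order.add_one_le_of_lt (by exact_mod_cast hlt)
    rw [hord x hxU] at hle
    obtain ⟨t, ht, htf⟩ := hle f hf𝔍
    exact hg (𝔓 x hxU) h𝔭𝔮 hgx t ht htf

/-- **Upper semicontinuity of the order, general form**: on a Noetherian regular scheme whose affine
coordinate rings are J-2, for ANY ideal sheaf `J` and every `n : ℕ∞`, the set `{x | n ≤ ord_x(J)}` is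
closed.  (The tree's `Resolution.isClosed_setOf_le_idealOrder_of_isJ2` assumes `X` integral and `J ≠ ⊥`;
here the points of infinite order are simply members of every super-level set.)
[cite: CossartPiltant2008, Prop. 4.2 (proof)] -/
theorem isClosed_setOf_le_idealOrder_of_isJ2_general {X : Scheme.{u}} [IsNoetherian X]
    (hX : Scheme.IsRegular X) (hJ2 : ∀ U : X.affineOpens, IsJ2Ring Γ(X, U))
    (J : X.IdealSheafData) (n : ℕ∞) :
    IsClosed {x : X | n ≤ idealOrder J x} := by
  set S := {x : X | n ≤ idealOrder J x} with hSdef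
  have hstab : StableUnderSpecialization S := stableUnderSpecialization_setOf_le_idealOrder hX J n
  refine isClosed_of_closure_subset fun y hy => ?_
  obtain ⟨ξ, hξy, hξ⟩ := exists_specializes_mem_closure_inter S hy
  -- it suffices that `ξ ∈ S`
  suffices hξS : ξ ∈ S from hstab hξy hξS
  by_contra hξS
  -- the order at `ξ` is finite, for otherwise `ξ ∈ S`
  have htop : idealOrder J ξ ≠ ⊤ := fun h => hξS (show n ≤ idealOrder J ξ by rw [h]; exact le_top)
  obtain ⟨m, hm⟩ := ENat.ne_top_iff_exists.mp htop
  have hmn : (m : ℕ∞) < n := by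
    rw [hm]; exact not_le.mp hξS
  obtain ⟨U, hξU, hU⟩ := exists_opens_forall_idealOrder_le_of_isJ2_general hX hJ2 J ξ hm.symm
  -- `S ∩ closure {ξ}` misses the open neighbourhood `U` of `ξ`
  have hdisj : S ∩ closure {ξ} ⊆ (U : Set X)ᶜ := by
    rintro z ⟨hzS, hzξ⟩ hzU
    have hξz : ξ ⤳ z := specializes_iff_mem_closure.mpr hzξ
    have := hU z hzU hξz
    exact (lt_irrefl _) (lt_of_le_of_lt (le_trans hzS this) hmn)
  have : ξ ∈ (U : Set X)ᶜ := (U.2.isClosed_compl.closure_subset_iff.mpr hdisj) hξ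
  exact this hξU

/-- **Upper semicontinuity of the order** on a Noetherian regular EXCELLENT scheme, for any ideal sheaf
and any `n : ℕ∞`, without integrality. [cite: CossartPiltant2008, Prop. 4.2 (proof)] -/
theorem isClosed_setOf_le_idealOrder_general {X : Scheme.{u}} [IsNoetherian X]
    (hX : Scheme.IsRegular X) (hE : Scheme.IsExcellent X) (J : X.IdealSheafData) (n : ℕ∞) :
    IsClosed {x : X | n ≤ idealOrder J x} :=
  isClosed_setOf_le_idealOrder_of_isJ2_general hX
    (fun U => ((hE U).isQuasiExcellentRing).isJ2Ring) J n

/-! ## The ideal sheaf of a global section (bridge lemmas drafted by res-type-071) -/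

section Bridge

variable {X : Scheme.{u}}

/-- The stalk at `x` of the ideal sheaf generated by a global ideal `I` is generated by the germs of `I`.
(res-type-071, `GermOrderBridge.lean`.) [folklore] -/
theorem stalkIdeal_ofIdealTop (I : Ideal Γ(X, ⊤)) (x : X) :
    stalkIdeal (Scheme.IdealSheafData.ofIdealTop I) x = I.map (X.presheaf.germ ⊤ x trivial).hom := by
  obtain ⟨U, hU, hxU, -⟩ :=
    exists_isAffineOpen_mem_and_subset (X := X) (x := x) (U := ⊤) (Opens.mem_top x)
  rw [stalkIdeal_eq_map_germ _ ⟨U, hU⟩ hxU, Scheme.IdealSheafData.ofIdealTop_ideal, Ideal.map_map,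
    ← CommRingCat.hom_comp, X.presheaf.germ_res (homOfLE le_top) x hxU]

/-- For a global section `f`, the stalk of the ideal sheaf generated by `f` is the principal ideal of its
germ. (res-type-071, `GermOrderBridge.lean`.) [folklore] -/
theorem stalkIdeal_ofIdealTop_span_singleton (f : Γ(X, ⊤)) (x : X) :
    stalkIdeal (Scheme.IdealSheafData.ofIdealTop (Ideal.span {f})) x =
      Ideal.span {(X.presheaf.germ ⊤ x trivial).hom f} := by
  rw [stalkIdeal_ofIdealTop, Ideal.map_span, Set.image_singleton]

/-- `n ≤ ord_x(f) ↔ germ_x f ∈ 𝔪_xⁿ` for a global section `f`. (res-type-071, `GermOrderBridge.lean`.)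
[folklore] -/
theorem le_idealOrder_span_singleton_iff (f : Γ(X, ⊤)) (x : X) (n : ℕ) :
    (n : ℕ∞) ≤ idealOrder (Scheme.IdealSheafData.ofIdealTop (Ideal.span {f})) x ↔
      (X.presheaf.germ ⊤ x trivial).hom f ∈ maximalIdeal (X.presheaf.stalk x) ^ n := by
  rw [le_idealOrder_iff, stalkIdeal_ofIdealTop_span_singleton, Ideal.span_singleton_le_iff_mem]

/-- **The zero-germ locus of a section is open**: if `germ_x f = 0` then `f` vanishes on a neighbourhood
of `x`, where all germs of `f` vanish. [folklore] -/
theorem isOpen_setOf_germ_eq_zero (f : Γ(X, ⊤)) :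
    IsOpen {x : X | (X.presheaf.germ ⊤ x trivial).hom f = 0} := by
  rw [isOpen_iff_forall_mem_open]
  intro x hx
  have hx0 : (X.presheaf.germ ⊤ x trivial).hom f = (X.presheaf.germ ⊤ x trivial).hom 0 := by
    rw [map_zero]; exact hx
  obtain ⟨W, hxW, iU, iV, hW⟩ :=
    X.presheaf.germ_eq (U := ⊤) (V := ⊤) x (Opens.mem_top x) (Opens.mem_top x) f 0 hx0
  refine ⟨W, fun z hz => ?_, W.2, hxW⟩
  show (X.presheaf.germ ⊤ z trivial).hom f = 0
  rw [← X.presheaf.germ_res iU z hz, CommRingCat.hom_comp, RingHom.comp_apply, hW, map_zero, map_zero]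

end Bridge

end OrderSemicontinuity

/-! ## The smooth case: clause (c8) at ι = ord, Diff-free and over any field -/

open OrderSemicontinuity

universe u

/-- **Clause (c8) at the 𝔪-adic order, germ form**: for `Y` smooth and quasi-compact over ANY field `k₀`,
a global section `f ∈ Γ(Y, 𝒪_Y)` and `n : ℕ`, the super-level set `{y | germ_y f ∈ 𝔪_yⁿ}` of the order
function is closed.  Smooth ⇒ regular, locally of finite type over a field ⇒ excellent ⇒ J-2,
quasi-compact ⇒ Noetherian, and `OrderSemicontinuity.isClosed_setOf_le_idealOrder_general` for the ideal
sheaf generated by `f`.  [OURS · L1 W4.3 · door H2a‴ clause (c8) instance]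
[cite: CossartPiltant2008, Prop. 4.2 (proof)] -/
theorem isClosed_setOf_germ_mem_maximalIdeal_pow (k₀ : Type u) [Field k₀] (Y : Scheme.{u})
    (hY : Y ⟶ Spec (CommRingCat.of k₀)) [Smooth hY] [QuasiCompact hY] (f : Γ(Y, ⊤)) (n : ℕ) :
    IsClosed {y : Y | (Y.presheaf.germ ⊤ y trivial).hom f ∈ maximalIdeal (Y.presheaf.stalk y) ^ n} := by
  haveI : CompactSpace Y := (quasiCompact_iff_compactSpace hY).mp inferInstance
  haveI : IsLocallyNoetherian Y := LocallyOfFiniteType.isLocallyNoetherian hY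
  haveI : IsNoetherian Y := {}
  have hreg : Scheme.IsRegular Y := by
    letI : Y.Over (Spec (CommRingCat.of k₀)) := ⟨hY⟩
    haveI : Smooth (Y ↘ Spec (CommRingCat.of k₀)) := ‹Smooth hY›
    exact Scheme.isRegular_of_smooth_over_field k₀ Y
  have hE : Scheme.IsExcellent Y := Scheme.isExcellent_of_locallyOfFiniteType Stacks07QW_field_holds hY
  have hcl := isClosed_setOf_le_idealOrder_general hreg hE
    (Scheme.IdealSheafData.ofIdealTop (Ideal.span {f})) (n : ℕ∞)
  have hset : {y : Y | (Y.presheaf.germ ⊤ y trivial).hom f ∈ maximalIdeal (Y.presheaf.stalk y) ^ n} =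
      {y : Y | (n : ℕ∞) ≤ idealOrder (Scheme.IdealSheafData.ofIdealTop (Ideal.span {f})) y} := by
    ext y
    exact (le_idealOrder_span_singleton_iff f y n).symm
  rw [hset]
  exact hcl

/-- The same closed sets indexed by `n : ℕ∞` (`n = ⊤`: the locus where the germ of `f` lies in every
power of the maximal ideal, i.e. — the stalks being Noetherian local rings — where it vanishes).
[OURS · L1 W4.3] [cite: CossartPiltant2008, Prop. 4.2 (proof)] -/
theorem isClosed_setOf_le_idealOrder_span_singleton (k₀ : Type u) [Field k₀] (Y : Scheme.{u})
    (hY : Y ⟶ Spec (CommRingCat.of k₀)) [Smooth hY] [QuasiCompact hY] (f : Γ(Y, ⊤)) (n : ℕ∞) :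
    IsClosed {y : Y | n ≤ idealOrder (Scheme.IdealSheafData.ofIdealTop (Ideal.span {f})) y} := by
  haveI : CompactSpace Y := (quasiCompact_iff_compactSpace hY).mp inferInstance
  haveI : IsLocallyNoetherian Y := LocallyOfFiniteType.isLocallyNoetherian hY
  haveI : IsNoetherian Y := {}
  have hreg : Scheme.IsRegular Y := by
    letI : Y.Over (Spec (CommRingCat.of k₀)) := ⟨hY⟩
    haveI : Smooth (Y ↘ Spec (CommRingCat.of k₀)) := ‹Smooth hY›
    exact Scheme.isRegular_of_smooth_over_field k₀ Y
  exact isClosed_setOf_le_idealOrder_general hreg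
    (Scheme.isExcellent_of_locallyOfFiniteType Stacks07QW_field_holds hY) _ n

/-- **The zero-germ locus is clopen** on a smooth quasi-compact scheme over a field: open by
`OrderSemicontinuity.isOpen_setOf_germ_eq_zero`, closed as the `n = ⊤` super-level set of the order
(Krull's intersection theorem in the Noetherian local ring `𝒪_{Y,y}`).  This is the junk branch of any
`Nat.sSup`-valued order function (value `0` at a zero germ). [OURS · L1 W4.3] [folklore] -/
theorem isClopen_setOf_germ_eq_zero (k₀ : Type u) [Field k₀] (Y : Scheme.{u})
    (hY : Y ⟶ Spec (CommRingCat.of k₀)) [Smooth hY] [QuasiCompact hY] (f : Γ(Y, ⊤)) :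
    IsClopen {y : Y | (Y.presheaf.germ ⊤ y trivial).hom f = 0} := by
  refine ⟨?_, isOpen_setOf_germ_eq_zero f⟩
  haveI : IsLocallyNoetherian Y := LocallyOfFiniteType.isLocallyNoetherian hY
  have hset : {y : Y | (Y.presheaf.germ ⊤ y trivial).hom f = 0} =
      {y : Y | (⊤ : ℕ∞) ≤ idealOrder (Scheme.IdealSheafData.ofIdealTop (Ideal.span {f})) y} := by
    ext y
    simp only [Set.mem_setOf_eq, top_le_iff]
    constructor
    · intro h
      refine ENat.eq_top_iff_forall_ge.mpr fun m => ?_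
      rw [le_idealOrder_span_singleton_iff, h]
      exact Ideal.zero_mem _
    · intro h
      have hall : ∀ m : ℕ, (Y.presheaf.germ ⊤ y trivial).hom f ∈ maximalIdeal (Y.presheaf.stalk y) ^ m :=
        fun m => (le_idealOrder_span_singleton_iff f y m).mp (by rw [h]; exact le_top)
      have hmem : (Y.presheaf.germ ⊤ y trivial).hom f ∈ ⨅ m : ℕ, maximalIdeal (Y.presheaf.stalk y) ^ m :=
        Ideal.mem_iInf.mpr hall
      rwa [Ideal.iInf_pow_eq_bot_of_isLocalRing _ (IsLocalRing.maximalIdeal.isMaximal _).ne_top,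
        Ideal.mem_bot] at hmem
  rw [hset]
  exact isClosed_setOf_le_idealOrder_span_singleton k₀ Y hY f ⊤

end Summit.ResolutionOfSingularities.ResolutionOfSingularities.Theorems

end
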